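import Mathlib
import HarnessLib

/-!
# `NoHeavyLowerTail` (crux stmt-CriticalPhenomena-4575), antithetic vdBHK programme: the DEPTH-1 (neck / relative hub) calculus — scalar skeleton

Support file (seat `prim-ineq-gen-7` gen 34; `--supports stmt-CriticalPhenomena-4575`).  Nothing is asserted about the crux; no `sorry`,
no definitions.  Memo: run/shared/lean/prim/prim-ineq-gen-7/FINDING-NECK1-g34.md §1–§3 (depth-1 calculus, KEY IDENTITY, THEOREM B1),
building on FINDING-SPIDER-g33.md (THEOREM SP, potentials) and PROOF-PG-g32.md (HUB functional).

CONTEXT.  CONJECTURE HB asks for `HUB^{F_v(T₂)}_0 ≥ 0` for every root-degree-1 tree `T₂`; hub steps (root-edge subdivision) are handled by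
THEOREM SP's potential `π*`.  The remaining `⋈`-step (adding a branch at the lower end of the root edge) is organised in gen 34 by the
'neck monotonicity' functional `NM^G(D) = HUB⁺(G ⋈ K22)(D) − HUB⁺(G)(D|copy 2)` (`HUB⁺ = HUB − Σ π*`): the J-rule
`NM^{G₁} ≥ 0 ∧ HUB⁺(G₁ ⋈ H) ≥ 0 ⟹ HUB⁺(G₁ ⋈ hub H) ≥ 0` and the H-rule `NM^{hub G′} − NM^{G′} = MIX + Σ_levels LOCAL₁`.  At a level the
six level elements `(B′,i), (T′,i), (τ′,i)` (`i = 1,2`) contribute certificate values `f(memberships; routes)`; the sibling top pairs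
`((t,1),(t,2))` carry the NECK EXCESS `W = f(m¹;k¹∨k²) + f(m²;k¹) − f(m¹;k¹) − f(m²;k²)`.  This file records the scalar facts the argument
is assembled from:

* `AntitheticNeck.neck_excess_telescope` — the KEY IDENTITY of FINDING-NECK1 §2: the depth-1 level functional equals THEOREM SP's level
  slack of copy 1 plus the telescoped neck excess, `LOCAL₁ = LEV₀(copy 1) + W(T′) + W(τ′,new) − W(τ′,old)` (pure regrouping of the `f`-values).
* `AntitheticNeck.pair_potential_reform` — hence a pair potential `ψ = W + θ` turns the depth-1 level lemma into an SP-type inequality for `θ`.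
* `AntitheticNeck.base_cert_vanish`, `AntitheticNeck.route_sup_empty` — the remark `BASE^G(zt=1) = HUB^G(U = full, AL = ∅; 1,1)` at one element:
  with all `U`-memberships present no `(·,U)`-certificate exists, and empty `AL`-routes do not change the `(B∨AL,T)`-routes.
* `AntitheticNeck.jrule_chain` — the telescoping along the J-rule / H-rule chains (`H_{a+1} = H_a + MIX_a + S_a`, `MIX, S ≥ 0`).
-/

namespace Summit.CriticalPhenomena.PercolationContinuityZ3.Theorems

open Finset

namespace AntitheticNeck

/-- **KEY IDENTITY** (FINDING-NECK1-g34 §2).  At one level of `hub(G′) ⋈ K22` write the certificate values (`f = h − π*`) of the level tops as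
integers: `fT1all = f(T′¹; all four bottom routes)`, `fT1own = f(T′¹; copy-1 routes)`, `fT2cross = f(T′²; copy-1 routes)`, `fT2own = f(T′²; copy-2 routes)`,
`fU1n12 = f(τ′¹; B′¹∨B′²)`, `fU1n1 = f(τ′¹; B′¹)`, `fU1o12 = f(τ′¹; α¹∨α²)`, `fU1o1 = f(τ′¹; α¹)`, `fU2n1 = f(τ′²; B′¹)`, `fU2n2 = f(τ′²; B′²)`,
`fU2o1 = f(τ′²; α¹)`, `fU2o2 = f(τ′²; α²)`, and `P`, `hB` for the copy-1 products and the hub-bottom certificates.  Then the depth-1 level functional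
`LOCAL₁ = (G⁺ level terms) − (instance NM^{G′} terms) − (own copy-2 terms)` equals THEOREM SP's level slack of copy 1 plus the telescoped
NECK EXCESS `W(σ) = f(m¹;k¹∨k²) + f(m²;k¹) − f(m¹;k¹) − f(m²;k²)` of the three sibling pairs (T′-pair, τ′-pair with new routes, τ′-pair with old routes). [this work] -/
theorem neck_excess_telescope
    (P hB fT1all fT1own fT2cross fT2own fU1n12 fU1n1 fU1o12 fU1o1 fU2n1 fU2n2 fU2o1 fU2o2 : ℤ)
    (local1 lev0 WT WN WO : ℤ)
    (hlocal : local1 = (P + hB + fT1all + fT2cross + fU1n12 + fU2n1) - (fU1o12 + fU2o1 - fU2o2) - (fT2own + fU2n2))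
    (hlev0 : lev0 = P + hB + fT1own + fU1n1 - fU1o1)
    (hWT : WT = fT1all + fT2cross - fT1own - fT2own)
    (hWN : WN = fU1n12 + fU2n1 - fU1n1 - fU2n2)
    (hWO : WO = fU1o12 + fU2o1 - fU1o1 - fU2o2) :
    local1 = lev0 + WT + WN - WO := by
  subst hlocal hlev0 hWT hWN hWO
  ring

/-- **Pair potentials as SP-type surpluses** (FINDING-NECK1-g34 §2, COROLLARY).  If `ψ = W + θ` on the three pairs of a level, the depth-1 level
inequality `LOCAL₁ ≥ ψ(T′) + ψ(new) − ψ(old)` is EQUIVALENT to `LEV₀(copy 1) ≥ θ(T′) + θ(new) − θ(old)`. [this work] -/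
theorem pair_potential_reform (local1 lev0 WT WN WO ψT ψN ψO θT θN θO : ℤ)
    (hid : local1 = lev0 + WT + WN - WO) (hT : ψT = WT + θT) (hN : ψN = WN + θN) (hO : ψO = WO + θO) :
    (ψT + ψN - ψO ≤ local1 ↔ θT + θN - θO ≤ lev0) := by
  subst hid hT hN hO
  constructor <;> intro h <;> linarith

/-- **`BASE = HUB` on the embedded data, certificate part** (FINDING-NECK1-g34 §1d): a `(X,U)`-certificate at an element needs a missing
`U`-membership (`¬U_{a′} ∧ ¬U_b` or `¬U_a ∧ ¬U_{b′}`); if the element lies in all four `U`-sets there is none.  (`k` = route bits of `X`.) [this work] -/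
theorem base_cert_vanish (ka ka' kb kb' : Bool) :
    ((ka && !true && !true && kb') || (!true && ka' && kb && !true)) = false := by
  simp

/-- **`BASE = HUB` on the embedded data, route part** (FINDING-NECK1-g34 §1d): with `AL = ∅` the routes of `B ∨ AL` are the routes of `B`, so
`c(B∨AL,T) = c(B,T)`, and `AL` has no routes at all, so `c(AL,U) = 0`. [this work] -/
theorem route_sup_empty (kB : Bool) : (kB || false) = kB ∧ ((false && !true && !true && false) || (!true && false && false && !true)) = false := by
  simp

/-- **Telescoping along a J-rule / H-rule chain** (FINDING-NECK1-g34 §1b/§3b): if `H 0 ≥ 0` and every step decomposes as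
`H (a+1) = H a + mix a + S a` with the Kleitman gain `mix a ≥ 0` and the slice / level sum `S a ≥ 0` (neck monotonicity of the slice, resp. the
potential-corrected level lemma), then `H a ≥ 0` for all `a`. [this work] -/
theorem jrule_chain (H mix S : ℕ → ℤ) (h0 : 0 ≤ H 0) (hstep : ∀ a, H (a + 1) = H a + mix a + S a)
    (hmix : ∀ a, 0 ≤ mix a) (hS : ∀ a, 0 ≤ S a) : ∀ a, 0 ≤ H a := by
  intro a
  induction a with
  | zero => exact h0
  | succ n ih => rw [hstep n]; have := hmix n; have := hS n; linarith

/-- **Potential form of the H-rule chain** (FINDING-NECK1-g34 §3b): if `NM₀ ≥ Ψ₀` (BASE₁), `NM_{b+1} − Ψ_{b+1} ≥ NM_b − Ψ_b` (level lemma with the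
pair potential, summed over levels, plus `MIX ≥ 0`) and `Ψ_b ≥ 0` (potentials are nonnegative), then `NM_b ≥ 0` for all `b`
(neck monotonicity of every slice `hub^b(1)`). [this work] -/
theorem neck_potential_induction (NM Ψ : ℕ → ℤ) (h0 : Ψ 0 ≤ NM 0) (hstep : ∀ b, NM b - Ψ b ≤ NM (b + 1) - Ψ (b + 1))
    (hΨ : ∀ b, 0 ≤ Ψ b) : ∀ b, 0 ≤ NM b := by
  have key : ∀ b, Ψ b ≤ NM b := by
    intro b
    induction b with
    | zero => exact h0
    | succ n ih => have := hstep n; linarith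
  intro b
  exact le_trans (hΨ b) (key b)

end AntitheticNeck

end Summit.CriticalPhenomena.PercolationContinuityZ3.Theorems
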